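import Summits.BirchSwinnertonDyer.Rank1Residual.AdditivePotMult.QuadraticBaseChangeDescentUnramifiedOddPrime
import Summits.BirchSwinnertonDyer.Rank1Residual.Additive.CyclotomicThreeDescentData
import Literature.NumberTheory.EllipticCurves.BSDSelmerParityDokchitserProp417Proofs
import Literature.NumberTheory.EllipticCurves.KramerDescent
import HarnessLib

/-!
# Dokchitser–Dokchitser's `C(W ⊗ K)` at the potentially multiplicative ramified prime:
# `v_p C(W ⊗ K) = v_p ∏_w c_w(W_K) + 1` (row T-MIL-UNI, FILE U-1a; seat n1011-p01 GEN 10)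

HONEST FRAMING (cell `b2b-bsdres`, run/shared/lean/b2b/bsd-rank1-residual/, verbatim in every
file): the goal of the cell is to DELETE the COMBINATION-SHAPED residual classes of the
Birch–Swinnerton-Dyer formula for ALL analytic-rank `≤ 1` elliptic curves over `ℚ` — "full BSD
formula for every rank `≤ 1` curve in class `C`" assembled STRICTLY from published theorems — so
that the rank-`≤ 1` remainder becomes exactly the CONSTRUCTION-SHAPED classes, which are TYPED
(missing-input `Prop`s), NOT attempted. This is not "finishing BSD". Sub-classes X3♯(M) / X4(M)
(additive, potentially multiplicative prime; base-change-and-descend): a RESEARCH ROUTE; they stay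
CONSTRUCTION-SHAPED; nothing is booked by this file; no mark / label moved. THEOREMS ONLY: no
definition, no named fact, no `sorry`.

## Why (row T-MIL-UNI, `cells/n1011/skel/T-MIL-UNI.md` §0)

Every Milne-free END of the T-MIL chain (FILES C-3f … J-4) concludes from Miller's over-`K` input
`MissingPPartOverAt W' p` on a GLOBALLY MINIMAL `K`-model `W' = C' • W_K`. For the twist-supply
fields `K = ℚ(√(p*·n))` of additive-p1's uniform class theorems (`TwistSupplyX4.bsdp_of_classX4M`)
the ramified prime of `K` above `p` is in general not principal, so no globally minimal `K`-model of
`E_K` exists (`ModelFree.lean`, module docstring) and the uniform theorems carry the MODEL-FREE input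
`MissingPPartOverCAt (W.baseChange K) p` (Dokchitser–Dokchitser's `C(E/K, ω) = ∏_w c_w |ω/ω°_w|_w`,
tree `WeierstrassCurve.modifiedTamagawaProduct`) — together with Milne's Weil-restriction identity as
the NAMED FACT A73 `hMilneC`. FILES U-1a/U-1b are the bridge that lets the T-MIL identities
(Milne-free) reach that currency. This file:

* `padicValRat_localTamagawaFactor_eq_add` — **`v_p C_w(X) = v_p c_w(X) + [w ∣ p]·f(w|p)·k_w(X)`**
  for ANY `K`-model `X` (model-free; `C_w = c_w · N(w)^{k_w}`, `N(w) = ℓ_w^{f_w}`);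
* `neronExponent_baseChange_eq_one_of_mult_twist` — **`k_𝔭(W ⊗ K) = 1`** at the potentially
  multiplicative ramified prime: `W/ℚ` globally minimal, `W_d = C_d • W^{(d)}` globally minimal
  MULTIPLICATIVE at `ℓ ∥ d` odd, `θ² = d` in `K`, `e(𝔭|ℓ) = 2`: the canonical model is non-minimal at
  `𝔭` by exactly one `π`-scaling, `k_𝔭 = (ord_𝔭 Δ_W − ord_𝔭 Δ_min)/12 = ((2n+12) − 2n)/12`
  (additive-p1 A-4M `hasAdditiveReductionAt_and_ordMinimalDiscriminant_of_mult_twist`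
  (`ord_ℓ Δ_min(W) = n + 6`), A-4K `ordMinimalDiscriminant_baseChange_eq_mul_of_mult_twist`
  (`ord_𝔭 Δ_min(W_K) = 2n`), Mathlib `valuation_liesOver`);
* **`padicValRat_modifiedTamagawaProduct_baseChange_eq_succ_of_mult_twist`** — for `K` quadratic with
  `d_K` squarefree, `p ∣ d_K` odd, `W_d = C_d • W^{(d_K)}` multiplicative at `p`:
  `v_p C(W ⊗ K) = v_p ∏_w c_w(W_K) + 1` (finite products over a common finite set of places
  containing the unique ramified `𝔭 ∣ p`, `N𝔭 = p`; finite supports from the tree's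
  `mulSupport_localTamagawaNumber_finite`, `localTamagawaFactor_baseChange_int_eq_one` — the
  bookkeeping pattern of seat additive-p4's `Additive/CyclotomicThreeMultiplicativeReduction`).

FILE U-1b (`QuadraticBaseChangeThetaModel`) turns this into
`MissingPPartOverAt (⟨θ,0,0,0⟩ • W_K) p ↔ MissingPPartOverCAt (W.baseChange K) p` and the odd
Tamagawa identity for the θ-model; FILE U-2 descends. HONEST LIMITS: `d_K` squarefree, `p ∣ d_K`
odd, `W_d` multiplicative at `p`; nothing about `W` good or multiplicative at `p` (there the canonical
model is minimal at `𝔭`: p16's `Additive/QuadraticBaseChangeTamagawaCanonicalModel*`); TOOL theorems;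
closes no class; moves no mark; 0 facts.

References: T. Dokchitser, V. Dokchitser, Ann. of Math. 172 (2010) §1 Notation, §2.1
[DokchitserDokchitserAnnals2010]; J. H. Silverman, *AEC* 2nd ed., III.1 Table 3.1, VII.1 Prop. 1.3
[SilvermanAEC2009]; J. Neukirch, *ANT*, Ch. I Prop. (8.2) [NeukirchANT1999].
-/

noncomputable section

open scoped Classical NumberField

open WeierstrassCurve NumberField IsDedekindDomain Rat.HeightOneSpectrum WithZero
  Literature.NumberTheory.EllipticCurves Literature.NumberTheory.EllipticCurves.Rank1Residual
  Summit.BirchSwinnertonDyer.Rank1Residual.Additive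

namespace Summit.BirchSwinnertonDyer.Rank1Residual.AdditivePotMult

/-! ## §0 Bookkeeping (`v_p` of a finite product: the tree's `padicValRat_finset_prod`, `KramerDescent`) -/

section Bookkeeping

variable {K : Type*} [Field K] [NumberField K]

/-- **`|N_{K/ℚ}(θ)| = |d|` for `θ² = d` in a quadratic field** (`N(θ)² = N(θ²) = N(d) = d²`).
[folklore] -/
theorem abs_norm_eq_abs_of_sq_eq (h2 : Module.finrank ℚ K = 2) {θ : K} {d : ℚ}
    (hθ : θ ^ 2 = algebraMap ℚ K d) : |Algebra.norm ℚ θ| = |d| := by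
  have h : (Algebra.norm ℚ θ) ^ 2 = d ^ 2 := by
    rw [← map_pow, hθ, Algebra.norm_algebraMap, h2]
  exact (sq_eq_sq_iff_abs_eq_abs _ _).mp h

end Bookkeeping

/-! ## §1 Dokchitser–Dokchitser's local factors of a `K`-model, `p`-adically; `k_𝔭 = 1` at the
potentially multiplicative ramified prime -/

section LocalFactor

variable {K : Type} [Field K] [NumberField K]

/-- **`v_p C_w(X) = v_p c_w(X) + [w ∣ p]·f(w|p)·k_w(X)`** for ANY `K`-model `X` and any finite place
`w` (`C_w = c_w · N(w)^{k_w}`, `N(w) = ℓ_w^{f_w}`; `p = ℓ_{v₀}`): Dokchitser–Dokchitser's local factor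
read `p`-adically. [cite: DokchitserDokchitserAnnals2010, §1 Notation (arXiv pp. 4–5)]
[cite: NeukirchANT1999, Ch. I, Prop. (8.2)] -/
theorem padicValRat_localTamagawaFactor_eq_add (X : WeierstrassCurve K) [X.IsElliptic]
    (v₀ : HeightOneSpectrum (𝓞 ℚ)) (w : HeightOneSpectrum (𝓞 K)) :
    padicValRat (primesEquiv v₀ : ℕ) (X.localTamagawaFactor w) =
      padicValNat (primesEquiv v₀ : ℕ) ((X.baseChange (w.adicCompletion K)).localTamagawaNumber
          (w.adicCompletionIntegers K)) +
        (if w.under (𝓞 ℚ) = v₀ then (w.asIdeal.inertiaDeg (𝓞 ℚ) : ℤ) else 0) * X.neronExponent w := by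
  haveI hp : Fact (Nat.Prime (primesEquiv v₀ : ℕ)) := ⟨(primesEquiv v₀).2⟩
  have hc0 : ((X.baseChange (w.adicCompletion K)).localTamagawaNumber
      (w.adicCompletionIntegers K) : ℚ) ≠ 0 := by
    exact_mod_cast X.localTamagawaNumber_baseChange_ne_zero w
  have hN : Ideal.absNorm w.asIdeal ≠ 0 := by
    rw [Ne, Ideal.absNorm_eq_zero_iff]
    exact w.ne_bot
  have hN0 : ((Ideal.absNorm w.asIdeal : ℕ) : ℚ) ≠ 0 := by exact_mod_cast hN
  rw [localTamagawaFactor_def, padicValRat.mul hc0 (zpow_ne_zero _ hN0), padicValRat.zpow,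
    padicValRat.of_nat, padicValRat.of_nat, padicValNat_absNorm_asIdeal w v₀]
  split_ifs <;> push_cast <;> ring

variable (W : WeierstrassCurve ℚ) [W.IsElliptic] [W.IsGloballyMinimal]
  (Wd : WeierstrassCurve ℚ) [Wd.IsElliptic] [Wd.IsGloballyMinimal]
  (v : HeightOneSpectrum (𝓞 ℚ)) (𝔭 : HeightOneSpectrum (𝓞 K))

/-- **`k_𝔭(W ⊗ K) = 1` at the potentially multiplicative ramified prime.** `W/ℚ` globally minimal,
`W_d = C_d • W^{(d)}` globally minimal (`d ∈ ℤ`, `ℓ ∥ d`, `ℓ = ℓ_v` odd) MULTIPLICATIVE at `v`, `K` a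
number field containing `θ` with `θ² = d`, `𝔭 ∣ v` with `e(𝔭|v) = 2`: Dokchitser–Dokchitser's
exponent of the canonical model at `𝔭` is `(ord_𝔭 Δ_W − ord_𝔭 Δ_min(W_K))/12 = (2(n+6) − 2n)/12 = 1`
(`n = ord_v Δ_min(W_d)`; additive-p1 A-4M/A-4K, Silverman III.1 Table 3.1 `u¹²Δ' = Δ`).
[cite: DokchitserDokchitserAnnals2010, §1 Notation (arXiv pp. 4–5)]
[cite: SilvermanAEC2009, VII.1 Prop. 1.3 (a)–(b) and III.1 Table 3.1] -/
theorem neronExponent_baseChange_eq_one_of_mult_twist (hv2 : (primesEquiv v : ℕ) ≠ 2) {d : ℤ}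
    (h1 : ((primesEquiv v : ℕ) : ℤ) ∣ d) (h2 : ¬ ((primesEquiv v : ℕ) : ℤ) ^ 2 ∣ d)
    {Cd : VariableChange ℚ} (hCd : Cd • W.quadraticTwist (d : ℚ) = Wd)
    (hmult : Wd.HasMultiplicativeReductionAt v) {θ : K} (hθ0 : θ ≠ 0)
    (hθ : θ ^ 2 = algebraMap ℚ K (d : ℚ)) (h𝔭 : 𝔭.asIdeal.under (𝓞 ℚ) = v.asIdeal)
    (he : v.asIdeal.ramificationIdx' 𝔭.asIdeal = 2) :
    (W.baseChange K).neronExponent 𝔭 = 1 := by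
  -- `ord_v Δ_min(W) = n + 6`, `ord_𝔭 Δ_min(W_K) = 2n`
  obtain ⟨-, hordW⟩ :=
    hasAdditiveReductionAt_and_ordMinimalDiscriminant_of_mult_twist W Wd v hv2 h1 h2 hCd hmult
  have hordK := ordMinimalDiscriminant_baseChange_eq_mul_of_mult_twist W Wd 𝔭 hCd hθ0 hθ hmult h𝔭
  rw [he] at hordK
  -- `|Δ_W|_𝔭 = |Δ_W|_v ^ 2 = exp(-2(n+6))`
  have hΔQ := valuation_Δ_eq_of_isMinimalAt_holds v W (IsGloballyMinimal.isMinimal v)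
  haveI : 𝔭.asIdeal.LiesOver v.asIdeal := ⟨h𝔭.symm⟩
  have hlies := IsDedekindDomain.HeightOneSpectrum.valuation_liesOver K v 𝔭 W.Δ
  rw [hΔQ, ← WithZero.exp_nsmul, Int.nsmul_eq_mul, he] at hlies
  have hΔK : 𝔭.valuation K (W.baseChange K).Δ =
      WithZero.exp (-(2 * (W.ordMinimalDiscriminant v : ℤ))) := by
    rw [baseChange, map_Δ, ← hlies]
    congr 1
    push_cast
    ring
  rw [WeierstrassCurve.neronExponent, hΔK, WithZero.log_exp, hordK, hordW]
  push_cast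
  omega

/-- **`v_p C(W ⊗ K) = v_p ∏_w c_w(W_K) + 1`** for `W/ℚ` globally minimal, `K` quadratic with `d_K`
squarefree, `p ∣ d_K` odd, and `W_d = C_d • W^{(d_K)}` globally minimal MULTIPLICATIVE at `p` (so `W` is
additive, potentially multiplicative at `p`). Proof: `C = ∏ᶠ C_w`, `∏c = ∏ᶠ c_w` as finite products
over a common finite set of places containing the ramified `𝔭 ∣ p` (finite supports: tree
`mulSupport_localTamagawaNumber_finite`, `localTamagawaFactor_baseChange_int_eq_one`); termwise
`v_p C_w = v_p c_w` off `𝔭` and `v_p C_𝔭 = v_p c_𝔭 + 1·1` (`f(𝔭|p) = 1`, `k_𝔭 = 1`).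
[cite: DokchitserDokchitserAnnals2010, §1 Notation (arXiv pp. 4–5)]
[cite: SilvermanAEC2009, VII.1 Prop. 1.3 (a)–(b)] -/
theorem padicValRat_modifiedTamagawaProduct_baseChange_eq_succ_of_mult_twist
    (h2 : Module.finrank ℚ K = 2) (hdsq : Squarefree (NumberField.discr K))
    (p : ℕ) [hp : Fact p.Prime] (hp2 : p ≠ 2) (hpd : (p : ℤ) ∣ NumberField.discr K)
    {Cd : VariableChange ℚ} (hWd : Cd • W.quadraticTwist (NumberField.discr K : ℚ) = Wd)
    (hmult : Mult Wd p) :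
    padicValRat p (W.baseChange K).modifiedTamagawaProduct =
      padicValNat p (W.baseChange K).tamagawaProduct + 1 := by
  haveI : (W.baseChange K).IsElliptic := by rw [baseChange]; infer_instance
  -- the place `v₀` of `ℚ` at `p` and the unique (ramified) place `𝔭` of `K` above it
  set v₀ : HeightOneSpectrum (𝓞 ℚ) := (primesEquiv (R := 𝓞 ℚ)).symm ⟨p, hp.out⟩ with hv₀def
  have hv₀ : (primesEquiv v₀ : ℕ) = p := by rw [hv₀def, Equiv.apply_symm_apply]
  have hv₀2 : (primesEquiv v₀ : ℕ) ≠ 2 := by rw [hv₀]; exact hp2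
  have hd1 : ((primesEquiv v₀ : ℕ) : ℤ) ∣ NumberField.discr K := by rw [hv₀]; exact hpd
  have hd2 : ¬ ((primesEquiv v₀ : ℕ) : ℤ) ^ 2 ∣ NumberField.discr K :=
    not_sq_dvd_of_squarefree hdsq _ (primesEquiv v₀).2
  have hmultv : Wd.HasMultiplicativeReductionAt v₀ := by
    have hm : (haveI := Fact.mk (primesEquiv v₀).2
        Wd.HasMultiplicativeReductionAtPrime (primesEquiv v₀)) := by
      have h : Wd.HasMultiplicativeReductionAtPrime p := hmult
      clear_value v₀
      subst hv₀
      exact h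
    exact (Wd.hasMultiplicativeReductionAtPrime_iff_hasMultiplicativeReductionAt_ringOfIntegers v₀).mp hm
  obtain ⟨𝔭, hset, he, hf⟩ : ∃ 𝔭 : HeightOneSpectrum (𝓞 K),
      {w' : HeightOneSpectrum (𝓞 K) | w'.under (𝓞 ℚ) = v₀} = {𝔭} ∧
        𝔭.asIdeal.ramificationIdx (𝓞 ℚ) = 2 ∧ 𝔭.asIdeal.inertiaDeg (𝓞 ℚ) = 1 := by
    rcases placesOver_trichotomy_of_finrank_eq_two K h2 v₀ with
      ⟨w₁, w₂, hne, hset, -⟩ | ⟨w, hset, he, -⟩ | ⟨w, hset, he, hf⟩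
    · exact absurd hd1 (not_dvd_and_isSquare_discr_of_split v₀ h2 hv₀2 hne hset).1
    · exact absurd hd1 (not_dvd_discr_of_fibre_eq_singleton K v₀ hset he)
    · exact ⟨w, hset, he, hf⟩
  have h𝔭v : 𝔭.under (𝓞 ℚ) = v₀ := under_eq_of_fibre_eq_singleton hset
  have h𝔭 : 𝔭.asIdeal.under (𝓞 ℚ) = v₀.asIdeal := by rw [← h𝔭v]; rfl
  have he' : v₀.asIdeal.ramificationIdx' 𝔭.asIdeal = 2 := by
    rw [ramificationIdx'_eq_of_under_eq h𝔭v, he]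
  obtain ⟨θ, hθ0, hθ⟩ := exists_sq_eq_discr h2
  have hk : (W.baseChange K).neronExponent 𝔭 = 1 :=
    neronExponent_baseChange_eq_one_of_mult_twist W Wd v₀ 𝔭 hv₀2 hd1 hd2 hWd hmultv hθ0 hθ h𝔭 he'
  -- the two local functions and a common finite index set containing `𝔭`
  set VK := W.baseChange K with hVK
  set c : HeightOneSpectrum (𝓞 K) → ℕ := fun w ↦
    (VK.baseChange (w.adicCompletion K)).localTamagawaNumber (w.adicCompletionIntegers K) with hc
  set C : HeightOneSpectrum (𝓞 K) → ℚ := fun w ↦ VK.localTamagawaFactor w with hC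
  have hfin_c : (Function.mulSupport c).Finite := VK.mulSupport_localTamagawaNumber_finite_holds
  have hΔ0 : (integralModelInt W).Δ ≠ 0 := minimalDiscriminantInt_ne_zero W
  -- adapted from seat additive-p4's `Additive/CyclotomicThreeMultiplicativeReduction`
  -- (`padicValRat_modifiedTamagawaProduct_baseChange_of_isMinimalAt`): finite support of `C`
  have hfin_C : (Function.mulSupport C).Finite := by
    have hI : (Ideal.span {((integralModelInt W).Δ : 𝓞 K)} : Ideal (𝓞 K)) ≠ 0 := by
      rw [Ne, Ideal.zero_eq_bot, Ideal.span_singleton_eq_bot]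
      exact_mod_cast hΔ0
    refine (Ideal.finite_factors hI).subset fun w hw ↦ ?_
    rw [Function.mem_mulSupport] at hw
    rw [Set.mem_setOf_eq, Ideal.dvd_span_singleton]
    by_contra hnot
    apply hw
    obtain ⟨ℓ, hℓ, hℓw⟩ : ∃ ℓ : ℕ, ℓ.Prime ∧ (ℓ : 𝓞 K) ∈ w.asIdeal :=
      ⟨_, Nat.absNorm_under_prime w.asIdeal, Int.absNorm_under_mem w.asIdeal⟩
    have hd : ¬ (ℓ : ℤ) ∣ (integralModelInt W).Δ := by
      rintro ⟨m, hm⟩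
      apply hnot
      have : ((integralModelInt W).Δ : 𝓞 K) = (ℓ : 𝓞 K) * (m : 𝓞 K) := by
        rw [hm]; push_cast; ring
      rw [this]
      exact Ideal.mul_mem_right _ _ hℓw
    have h1 := localTamagawaFactor_baseChange_int_eq_one (L := K) (integralModelInt W) hΔ0 w hℓ hℓw hd
    rw [baseChange_integralModelInt_eq] at h1
    exact h1
  set s : Finset (HeightOneSpectrum (𝓞 K)) := hfin_c.toFinset ∪ hfin_C.toFinset ∪ {𝔭} with hs
  have hs_c : Function.mulSupport c ⊆ ↑s := by
    intro w hw
    simp only [hs, Finset.coe_union, Finset.coe_singleton, Set.Finite.coe_toFinset, Set.mem_union,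
      Set.mem_singleton_iff]
    exact Or.inl (Or.inl hw)
  have hs_C : Function.mulSupport C ⊆ ↑s := by
    intro w hw
    simp only [hs, Finset.coe_union, Finset.coe_singleton, Set.Finite.coe_toFinset, Set.mem_union,
      Set.mem_singleton_iff]
    exact Or.inl (Or.inr hw)
  have h𝔭s : 𝔭 ∈ s := by
    rw [hs, Finset.mem_union, Finset.mem_singleton]
    exact Or.inr rfl
  have hTam : VK.tamagawaProduct = ∏ w ∈ s, c w := by
    rw [WeierstrassCurve.tamagawaProduct]
    exact finprod_eq_prod_of_mulSupport_subset c hs_c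
  have hMod : VK.modifiedTamagawaProduct = ∏ w ∈ s, C w := by
    rw [modifiedTamagawaProduct_def]
    exact finprod_eq_prod_of_mulSupport_subset C hs_C
  -- termwise valuations
  have hC0 : ∀ w, C w ≠ 0 := fun w ↦ by
    show VK.localTamagawaFactor w ≠ 0
    rw [localTamagawaFactor_def]
    refine mul_ne_zero ?_ (zpow_ne_zero _ ?_)
    · exact_mod_cast VK.localTamagawaNumber_baseChange_ne_zero w
    · have h : Ideal.absNorm w.asIdeal ≠ 0 := by
        rw [Ne, Ideal.absNorm_eq_zero_iff]
        exact w.ne_bot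
      exact_mod_cast h
  have hc0 : ∀ w, ((c w : ℕ) : ℚ) ≠ 0 := fun w ↦ by
    exact_mod_cast VK.localTamagawaNumber_baseChange_ne_zero w
  have hterm : ∀ w, padicValRat p (C w) =
      padicValRat p ((c w : ℕ) : ℚ) + (if w = 𝔭 then (1 : ℤ) else 0) := by
    intro w
    have h := padicValRat_localTamagawaFactor_eq_add VK v₀ w
    rw [hv₀] at h
    rw [hC, h, padicValRat.of_nat]
    by_cases hw : w = 𝔭
    · subst hw
      rw [if_pos h𝔭v, if_pos rfl, hf, hk]
      push_cast
      ring
    · have hw' : ¬ w.under (𝓞 ℚ) = v₀ := by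
        intro hwv
        have hmem : w ∈ ({w' : HeightOneSpectrum (𝓞 K) | w'.under (𝓞 ℚ) = v₀} : Set _) := hwv
        rw [hset, Set.mem_singleton_iff] at hmem
        exact hw hmem
      rw [if_neg hw', if_neg hw]
      ring
  rw [hMod, hTam, ← padicValRat.of_nat, Nat.cast_prod,
    KramerParams.padicValRat_finset_prod s C (fun w _ => hC0 w),
    KramerParams.padicValRat_finset_prod s (fun w => ((c w : ℕ) : ℚ)) (fun w _ => hc0 w),
    Finset.sum_congr rfl (fun w _ => hterm w), Finset.sum_add_distrib, Finset.sum_ite_eq' s 𝔭,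
    if_pos h𝔭s]

end LocalFactor

end Summit.BirchSwinnertonDyer.Rank1Residual.AdditivePotMult

end
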